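import Literature.Geometry.Lorentzian.ObstructionFreeGluing
import Mathlib

/-!
# `ParametricKerrBurial`, line `receding-annulus-universal-collar` — stub `stub_bulkAsymptotics` (BK3g)
# (crux item stmt-FinalStateConjecture-10052), the registered statement proved

The `N → ∞` bookkeeping of the Brill–Lindquist ring design of the bulk (pure real analysis, no geometry): with ring
radius `L = M² T_N/(N² m₁)`, central weight `α₀ = μ' L/(4M)`, ring weight `α = (M/2 − α₀)/N`, site values
`b = 8 + α₀/L + α T_N/L`, `b₀ = 8 + N α/L` and the ring-sum orders `(N/2π) log(N/2) ≤ T_N ≤ N(1 + log N)`,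
`0 ≤ U_N ≤ N²`, `0 ≤ V_N ≤ N³` (the landed `stub_bulkRing`), all nineteen smallness / mass-window / separation
conditions consumed by `stub_bulkAt` hold for every large `N`.
* §1 one `N ≥ 3`: `T_N > 0`; the two orders `0 ≤ L ≤ (M²/m₁)(1/N + log N/N)`, `N L ≥ (M²/(2π m₁)) log(N/2)`; the
  normal form `b = 8 + μ'/(4M) + α N² m₁/M²`; the window `M/(4N) ≤ α ≤ M/(2N)` once `α₀ ≤ M/4`;
* §2 ring: `b ≥ N m₁/(4M)`, `1/b² ≤ 16M²/(m₁²N²)`, the mass window `m₁/8 ≤ 2αb ≤ m₁` (exact identity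
  `2ᾱ²T_N/L = m₁/2`, `ᾱ = M/(2N)`), and the `W`-bracket `≤ C_ring/(N L)`;
* §3 centre: `μ'/8 ≤ 2α₀b₀ ≤ m₁`, `b₀ ≥ M/(4L)`, `1/b₀² ≤ 16L²/M²`, the `W`-bracket `≤ (32/M² + 512/M⁴) L`;
* §4 the seven separation / cluster / reading-ball conditions from `1/b²`, `1/b₀²` and thresholds;
* §5 the limits `L → 0`, `N L → ∞`, whence every threshold of the shapes `c·L ≤ ε`, `c/N ≤ ε`, `R ≤ N L`,
  `c/(N L) ≤ ε` is eventually true; the registered statement.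

Elementary; no named facts.  References: the crux directory's `PICKED.md` (bulk design); Mathlib
`Real.isLittleO_log_id_atTop`, `Real.tendsto_log_atTop`, `squeeze_zero'`.
-/

set_option linter.dupNamespace false

noncomputable section

namespace Summit.FinalStateConjecture.FinalStateConjecture.Theorems.SwallowTheDatum.ParametricKerrBurial

open scoped Manifold ContDiff Topology BigOperators InnerProductSpace
open Bundle Set Filter Function MeasureTheory Literature.Geometry.Lorentzian
open Literature.Geometry.Lorentzian.MaoOhTao Literature.Geometry.Lorentzian.InitialDataSet

/-! ## §1 One `N ≥ 3`: `T_N > 0`, the orders of `L`, the normal form of `b`, the window for `α` -/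

/-- For `n ≥ 3` the lower ring-sum bound `(n/2π) log(n/2)` is positive, hence so is `T_N`. [folklore] -/
theorem bulkAsym_t_pos {n t : ℝ} (hn : 3 ≤ n) (ht : n / (2 * Real.pi) * Real.log (n / 2) ≤ t) : 0 < t := by
  have hn0 : 0 < n := by linarith
  have h1 : 0 < Real.log (n / 2) := Real.log_pos (by linarith)
  have h2 : 0 < n / (2 * Real.pi) := by positivity
  exact lt_of_lt_of_le (mul_pos h2 h1) ht

/-- The two orders of the ring radius `L = M² T_N/(N² m₁)` that drive everything:
`0 ≤ L ≤ (M²/m₁)(1/N + log N/N)` (so `L → 0`) and `N L ≥ (M²/(2π m₁)) log(N/2)` (so `N L → ∞`). [folklore] -/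
theorem bulkAsym_L_bounds {M m₁ n t l : ℝ} (hm₁ : 0 < m₁) (hn : 3 ≤ n)
    (ht1 : n / (2 * Real.pi) * Real.log (n / 2) ≤ t) (ht2 : t ≤ n * (1 + Real.log n))
    (hl : l = M ^ 2 * t / (n ^ 2 * m₁)) :
    0 ≤ l ∧ l ≤ M ^ 2 / m₁ * (1 / n + Real.log n / n) ∧
      M ^ 2 / (2 * Real.pi * m₁) * Real.log (n / 2) ≤ n * l := by
  have hn0 : 0 < n := by linarith
  have ht : 0 < t := bulkAsym_t_pos hn ht1
  refine ⟨by rw [hl]; positivity, ?_, ?_⟩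
  · calc l = M ^ 2 / m₁ * (t / n ^ 2) := by rw [hl]; field_simp
      _ ≤ M ^ 2 / m₁ * (n * (1 + Real.log n) / n ^ 2) := by gcongr
      _ = M ^ 2 / m₁ * (1 / n + Real.log n / n) := by field_simp
  · calc M ^ 2 / (2 * Real.pi * m₁) * Real.log (n / 2)
        = M ^ 2 / m₁ * (n / (2 * Real.pi) * Real.log (n / 2)) / n := by field_simp
      _ ≤ M ^ 2 / m₁ * t / n := by gcongr
      _ = n * l := by rw [hl]; field_simp

/-- Normal form of the ring site value: `b = 8 + μ'/(4M) + α N² m₁/M²`. [folklore] -/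
theorem bulkAsym_bb_eq {M m₁ μ' n t l a0 a bb : ℝ} (hM : 0 < M) (hm₁ : 0 < m₁) (hn : 0 < n) (ht : 0 < t)
    (hl : l = M ^ 2 * t / (n ^ 2 * m₁)) (ha0 : a0 = μ' * l / (4 * M))
    (hbb : bb = 8 + a0 / l + a * t / l) : bb = 8 + μ' / (4 * M) + a * (n ^ 2 * m₁ / M ^ 2) := by
  rw [hbb, ha0, hl]
  field_simp

/-- Once `α₀ ≤ M/4`: `M/(4N) ≤ α ≤ M/(2N)`, `α > 0`, `N α = M/2 − α₀`. [folklore] -/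
theorem bulkAsym_a_bounds {M n a0 a : ℝ} (hM : 0 < M) (hn : 0 < n) (ha0 : 0 ≤ a0) (hsmall : a0 ≤ M / 4)
    (ha : a = (M / 2 - a0) / n) : M / (4 * n) ≤ a ∧ a ≤ M / (2 * n) ∧ 0 < a ∧ n * a = M / 2 - a0 := by
  refine ⟨?_, ?_, by rw [ha]; exact div_pos (by linarith) hn, by rw [ha]; field_simp⟩
  · rw [ha, div_le_div_iff₀ (by positivity) hn]
    nlinarith [mul_nonneg (sub_nonneg.2 hsmall) hn.le]
  · rw [ha, div_le_div_iff₀ hn (by positivity)]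
    nlinarith [mul_nonneg ha0 hn.le]

/-! ## §2 The ring: site value, mass window, `W`-bracket -/

/-- **Ring site value and mass window**: `b ≥ N m₁/(4M)`, `1/b² ≤ 16M²/(m₁²N²)`, and `m₁/8 ≤ 2αb ≤ m₁` once
`M(8 + μ'/(4M))/N ≤ m₁/2` (the exact identity `2ᾱ² N² m₁/M² = m₁/2` at `ᾱ = M/(2N)`). [folklore] -/
theorem bulkAsym_ring {M m₁ μ' n a bb : ℝ} (hM : 0 < M) (hm₁ : 0 < m₁) (hμ' : 0 < μ') (hn : 0 < n)
    (ha : M / (4 * n) ≤ a) (ha' : a ≤ M / (2 * n)) (hbb : bb = 8 + μ' / (4 * M) + a * (n ^ 2 * m₁ / M ^ 2))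
    (h3 : M * (8 + μ' / (4 * M)) / n ≤ m₁ / 2) :
    n * m₁ / (4 * M) ≤ bb ∧ 1 / bb ^ 2 ≤ 16 * M ^ 2 / (m₁ ^ 2 * n ^ 2) ∧ 2 * a * bb ≤ m₁ ∧ m₁ / 8 ≤ 2 * a * bb := by
  have ha0 : 0 ≤ a := le_trans (by positivity) ha
  have hk : a * (n ^ 2 * m₁ / M ^ 2) ≤ bb := by
    rw [hbb]
    have : 0 < μ' / (4 * M) := by positivity
    linarith
  have h1 : n * m₁ / (4 * M) ≤ bb := by
    calc n * m₁ / (4 * M) = M / (4 * n) * (n ^ 2 * m₁ / M ^ 2) := by field_simp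
      _ ≤ a * (n ^ 2 * m₁ / M ^ 2) := by gcongr
      _ ≤ bb := hk
  refine ⟨h1, ?_, ?_, ?_⟩
  · calc 1 / bb ^ 2 ≤ 1 / (n * m₁ / (4 * M)) ^ 2 := by gcongr
      _ = 16 * M ^ 2 / (m₁ ^ 2 * n ^ 2) := by field_simp; ring
  · calc 2 * a * bb = 2 * a * (8 + μ' / (4 * M)) + 2 * (a * a * (n ^ 2 * m₁ / M ^ 2)) := by rw [hbb]; ring
      _ ≤ 2 * (M / (2 * n)) * (8 + μ' / (4 * M)) + 2 * (M / (2 * n) * (M / (2 * n)) * (n ^ 2 * m₁ / M ^ 2)) := by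
          gcongr
      _ = M * (8 + μ' / (4 * M)) / n + m₁ / 2 := by field_simp
      _ ≤ m₁ := by linarith
  · calc m₁ / 8 = 2 * (M / (4 * n) * (M / (4 * n) * (n ^ 2 * m₁ / M ^ 2))) := by field_simp; ring
      _ ≤ 2 * (a * (a * (n ^ 2 * m₁ / M ^ 2))) := by gcongr
      _ ≤ 2 * (a * bb) := by gcongr
      _ = 2 * a * bb := by ring

/-- `1/(x y) ≤ 1/x` for `x > 0`, `y ≥ 1`. [folklore] -/
theorem bulkAsym_inv_le {x y : ℝ} (hx : 0 < x) (hy : 1 ≤ y) : 1 / (x * y) ≤ 1 / x :=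
  one_div_le_one_div_of_le hx (le_mul_of_one_le_right hx.le hy)

/-- **Ring `W`-bracket**: with `U ≤ N²`, `V ≤ N³`, `b ≥ N m₁/(4M)`, `α ≤ M/(2N)`, `α₀ ≤ μ' L/(4M)` and `N L ≥ 1`,
`(α₀ + αU)/(L² b³) + (α₀ + αV)/(L³ b⁵) ≤ C_ring/(N L)`. [folklore] -/
theorem bulkAsym_ringW {M m₁ μ' n l a0 a bb u v : ℝ} (hM : 0 < M) (hm₁ : 0 < m₁) (hμ' : 0 < μ') (hn : 1 ≤ n)
    (hl : 0 < l) (hnl : 1 ≤ n * l) (ha0' : a0 ≤ μ' * l / (4 * M)) (ha' : a ≤ M / (2 * n))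
    (hbb : n * m₁ / (4 * M) ≤ bb) (hu : 0 ≤ u) (hu' : u ≤ n ^ 2) (hv : 0 ≤ v) (hv' : v ≤ n ^ 3) :
    (a0 + a * u) / (l ^ 2 * bb ^ 3) + (a0 + a * v) / (l ^ 3 * bb ^ 5) ≤
      (16 * μ' * M ^ 2 / m₁ ^ 3 + 32 * M ^ 4 / m₁ ^ 3 + 256 * μ' * M ^ 4 / m₁ ^ 5 + 512 * M ^ 6 / m₁ ^ 5) *
        (1 / (n * l)) := by
  have hn0 : 0 < n := by linarith
  have hnl0 : 0 < n * l := by positivity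
  have e1 : 1 / (n * l * n ^ 2) ≤ 1 / (n * l) := bulkAsym_inv_le hnl0 (one_le_pow₀ hn)
  have e2 : 1 / (n * l * (n * l)) ≤ 1 / (n * l) := bulkAsym_inv_le hnl0 hnl
  have e3 : 1 / (n * l * (n * l * n ^ 3)) ≤ 1 / (n * l) :=
    bulkAsym_inv_le hnl0 (one_le_mul_of_one_le_of_one_le hnl (one_le_pow₀ hn))
  have e4 : 1 / (n * l * (n * l * (n * l))) ≤ 1 / (n * l) :=
    bulkAsym_inv_le hnl0 (one_le_mul_of_one_le_of_one_le hnl hnl)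
  have hX : (a0 + a * u) / (l ^ 2 * bb ^ 3) ≤
      (μ' * l / (4 * M) + M / (2 * n) * n ^ 2) / (l ^ 2 * (n * m₁ / (4 * M)) ^ 3) := by gcongr
  have hY : (a0 + a * v) / (l ^ 3 * bb ^ 5) ≤
      (μ' * l / (4 * M) + M / (2 * n) * n ^ 3) / (l ^ 3 * (n * m₁ / (4 * M)) ^ 5) := by gcongr
  have eX : (μ' * l / (4 * M) + M / (2 * n) * n ^ 2) / (l ^ 2 * (n * m₁ / (4 * M)) ^ 3) =
      16 * μ' * M ^ 2 / m₁ ^ 3 * (1 / (n * l * n ^ 2)) + 32 * M ^ 4 / m₁ ^ 3 * (1 / (n * l * (n * l))) := by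
    field_simp; ring
  have eY : (μ' * l / (4 * M) + M / (2 * n) * n ^ 3) / (l ^ 3 * (n * m₁ / (4 * M)) ^ 5) =
      256 * μ' * M ^ 4 / m₁ ^ 5 * (1 / (n * l * (n * l * n ^ 3))) +
        512 * M ^ 6 / m₁ ^ 5 * (1 / (n * l * (n * l * (n * l)))) := by
    field_simp; ring
  rw [eX] at hX
  rw [eY] at hY
  calc _ ≤ _ := add_le_add hX hY
    _ ≤ 16 * μ' * M ^ 2 / m₁ ^ 3 * (1 / (n * l)) + 32 * M ^ 4 / m₁ ^ 3 * (1 / (n * l)) +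
        (256 * μ' * M ^ 4 / m₁ ^ 5 * (1 / (n * l)) + 512 * M ^ 6 / m₁ ^ 5 * (1 / (n * l))) := by gcongr
    _ = _ := by ring

/-! ## §3 The centre: mass window, site value, `W`-bracket -/

/-- **Centre mass window**: `μ'/8 ≤ 2α₀b₀ ≤ m₁` once `4μ'L/M ≤ m₁/2` (and `α₀ ≤ M/4`, `μ' ≤ m₁`). [folklore] -/
theorem bulkAsym_centreMass {M m₁ μ' n l a0 a b0 : ℝ} (hM : 0 < M) (hμ' : 0 < μ') (hμ'le : μ' ≤ m₁)
    (hl : 0 < l) (ha0 : a0 = μ' * l / (4 * M)) (hsmall : a0 ≤ M / 4) (hna : n * a = M / 2 - a0)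
    (hb0 : b0 = 8 + n * a / l) (h7 : 4 * μ' / M * l ≤ m₁ / 2) :
    2 * a0 * b0 ≤ m₁ ∧ μ' / 8 ≤ 2 * a0 * b0 := by
  have ha0nn : 0 ≤ a0 := by rw [ha0]; positivity
  have key : 2 * a0 * b0 = 4 * μ' / M * l + μ' * (M / 2 - a0) / (2 * M) := by
    rw [hb0, hna, ha0]; field_simp; ring
  rw [key]
  constructor
  · have : μ' * (M / 2 - a0) / (2 * M) ≤ μ' / 4 := by
      rw [div_le_div_iff₀ (by positivity) (by positivity)]
      nlinarith [mul_nonneg hμ'.le ha0nn]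
    linarith
  · have : μ' / 8 ≤ μ' * (M / 2 - a0) / (2 * M) := by
      rw [div_le_div_iff₀ (by positivity) (by positivity)]
      nlinarith [mul_le_mul_of_nonneg_left hsmall hμ'.le]
    have : 0 ≤ 4 * μ' / M * l := by positivity
    linarith

/-- Central site value: `b₀ ≥ M/(4L)`, whence `1/b₀² ≤ 16 L²/M²`. [folklore] -/
theorem bulkAsym_b0_bounds {M n l a0 a b0 : ℝ} (hM : 0 < M) (hl : 0 < l) (hsmall : a0 ≤ M / 4)
    (hna : n * a = M / 2 - a0) (hb0 : b0 = 8 + n * a / l) :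
    M / (4 * l) ≤ b0 ∧ 1 / b0 ^ 2 ≤ 16 / M ^ 2 * (l * l) := by
  have h1 : M / (4 * l) ≤ b0 := by
    rw [hb0, hna]
    have : M / (4 * l) ≤ (M / 2 - a0) / l := by
      rw [div_le_div_iff₀ (by positivity) hl]
      nlinarith [mul_le_mul_of_nonneg_right hsmall hl.le]
    linarith
  refine ⟨h1, ?_⟩
  calc 1 / b0 ^ 2 ≤ 1 / (M / (4 * l)) ^ 2 := by gcongr
    _ = 16 / M ^ 2 * (l * l) := by field_simp; ring

/-- **Centre `W`-bracket**: `Nα/(L² b₀³) + Nα/(L³ b₀⁵) ≤ (32/M² + 512/M⁴) L` for `L ≤ 1`. [folklore] -/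
theorem bulkAsym_centreW {M n l a b0 : ℝ} (hM : 0 < M) (hl : 0 < l) (hl1 : l ≤ 1) (hna : n * a ≤ M / 2)
    (hb0 : M / (4 * l) ≤ b0) :
    n * a / (l ^ 2 * b0 ^ 3) + n * a / (l ^ 3 * b0 ^ 5) ≤ (32 / M ^ 2 + 512 / M ^ 4) * l := by
  have hP : n * a / (l ^ 2 * b0 ^ 3) ≤ (M / 2) / (l ^ 2 * (M / (4 * l)) ^ 3) := by gcongr
  have hQ : n * a / (l ^ 3 * b0 ^ 5) ≤ (M / 2) / (l ^ 3 * (M / (4 * l)) ^ 5) := by gcongr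
  have eP : (M / 2) / (l ^ 2 * (M / (4 * l)) ^ 3) = 32 / M ^ 2 * l := by field_simp; ring
  have eQ : (M / 2) / (l ^ 3 * (M / (4 * l)) ^ 5) = 512 / M ^ 4 * (l * l) := by field_simp; ring
  rw [eP] at hP
  rw [eQ] at hQ
  have hl2 : l * l ≤ l := by nlinarith
  calc _ ≤ 32 / M ^ 2 * l + 512 / M ^ 4 * (l * l) := add_le_add hP hQ
    _ ≤ 32 / M ^ 2 * l + 512 / M ^ 4 * l := by gcongr
    _ = _ := by ring

/-! ## §4 Separation / cluster / reading-ball conditions -/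

/-- The seven separation conditions, from `1/b² ≤ 16M²/(m₁²N²)`, `1/b₀² ≤ 16L²/M²` and the thresholds. [folklore] -/
theorem bulkAsym_separation {M m₁ ρ₃ n l bb b0 : ℝ} (hm₁ : 0 < m₁) (hn : 1 ≤ n)
    (hl : 0 < l) (hs : 1 / bb ^ 2 ≤ 16 * M ^ 2 / (m₁ ^ 2 * n ^ 2)) (hs0 : 1 / b0 ^ 2 ≤ 16 / M ^ 2 * (l * l))
    (h13a : l ≤ ρ₃ / 4096) (h13b : 4096 * M ^ 2 / m₁ ^ 2 / n ≤ ρ₃ / 4096)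
    (h15 : 1280 * M ^ 2 / m₁ ^ 2 + 1 ≤ n * l) (h16a : 2560 / M ^ 2 * l ≤ 1 / 4)
    (h16b : 4 * (2560 * M ^ 2 / m₁ ^ 2) ≤ n * l) (h17 : 2048 * M ^ 2 / m₁ ^ 2 ≤ n * l)
    (h18 : 4096 / M ^ 2 * l ≤ 1 / 2) (h19 : 4 * l ≤ ρ₃ / 512) :
    l + 256 / bb ^ 2 < ρ₃ / 1024 ∧ 256 / b0 ^ 2 < ρ₃ / 1024 ∧ 320 / bb ^ 2 < 4 * l / n ∧
      160 * (1 / b0 ^ 2 + 1 / bb ^ 2) < l ∧ 256 / bb ^ 2 ≤ 2 * l / n ∧ 256 / b0 ^ 2 ≤ l / 2 ∧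
      4 * l ≤ ρ₃ / 512 := by
  have hn0 : 0 < n := by linarith
  have c13 : l + 256 / bb ^ 2 < ρ₃ / 1024 := by
    have h16 : 16 * M ^ 2 / (m₁ ^ 2 * n ^ 2) ≤ 16 * M ^ 2 / m₁ ^ 2 / n := by
      rw [div_div]
      apply div_le_div_of_nonneg_left (by positivity) (by positivity)
      nlinarith [mul_nonneg (mul_nonneg hm₁.le hm₁.le) (sub_nonneg.2 hn)]
    have hs' := hs.trans h16
    have : 256 / bb ^ 2 ≤ 4096 * M ^ 2 / m₁ ^ 2 / n := by
      calc 256 / bb ^ 2 = 256 * (1 / bb ^ 2) := by ring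
        _ ≤ 256 * (16 * M ^ 2 / m₁ ^ 2 / n) := by gcongr
        _ = _ := by ring
    linarith
  have c18 : 256 / b0 ^ 2 ≤ l / 2 := by
    calc 256 / b0 ^ 2 = 256 * (1 / b0 ^ 2) := by ring
      _ ≤ 256 * (16 / M ^ 2 * (l * l)) := by gcongr
      _ = (4096 / M ^ 2 * l) * l := by ring
      _ ≤ (1 / 2) * l := by gcongr
      _ = l / 2 := by ring
  have c15 : 320 / bb ^ 2 < 4 * l / n := by
    calc 320 / bb ^ 2 = 320 * (1 / bb ^ 2) := by ring
      _ ≤ 320 * (16 * M ^ 2 / (m₁ ^ 2 * n ^ 2)) := by gcongr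
      _ = 4 * (1280 * M ^ 2 / m₁ ^ 2) / n ^ 2 := by ring
      _ < 4 * (n * l) / n ^ 2 := by gcongr; linarith
      _ = 4 * l / n := by field_simp
  have c16 : 160 * (1 / b0 ^ 2 + 1 / bb ^ 2) < l := by
    have ca : 160 * (1 / b0 ^ 2) ≤ l / 4 := by
      calc 160 * (1 / b0 ^ 2) ≤ 160 * (16 / M ^ 2 * (l * l)) := by gcongr
        _ = (2560 / M ^ 2 * l) * l := by ring
        _ ≤ 1 / 4 * l := by gcongr
        _ = l / 4 := by ring
    have cb : 160 * (1 / bb ^ 2) ≤ l / 4 := by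
      calc 160 * (1 / bb ^ 2) ≤ 160 * (16 * M ^ 2 / (m₁ ^ 2 * n ^ 2)) := by gcongr
        _ = (2560 * M ^ 2 / m₁ ^ 2) / n ^ 2 := by ring
        _ ≤ (n * l / 4) / n ^ 2 := div_le_div_of_nonneg_right (by linarith) (by positivity)
        _ = l / 4 / n := by field_simp
        _ ≤ l / 4 := div_le_self (by positivity) hn
    nlinarith
  have c17 : 256 / bb ^ 2 ≤ 2 * l / n := by
    calc 256 / bb ^ 2 = 256 * (1 / bb ^ 2) := by ring
      _ ≤ 256 * (16 * M ^ 2 / (m₁ ^ 2 * n ^ 2)) := by gcongr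
      _ = 2 * (2048 * M ^ 2 / m₁ ^ 2) / n ^ 2 := by ring
      _ ≤ 2 * (n * l) / n ^ 2 := by gcongr
      _ = 2 * l / n := by field_simp
  exact ⟨c13, by linarith, c15, c16, c17, c18, h19⟩

/-! ## §5 The two limits and the registered statement -/

/-- **STUB BK3g `stub_bulkAsymptotics`** (the `N → ∞` bookkeeping of the ring design, pure real analysis): with ring
radius `L = M² T_N/(N² m₁)`, central weight `α₀ = μ′L/(4M)`, ring weight `α = (M/2 − α₀)/N`, site values
`b = 8 + α₀/L + αT_N/L`, `b₀ = 8 + Nα/L` and the ring-sum orders of `stub_bulkRing`, every smallness / separation /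
window condition of the bulk holds for all large `N`.  Proof: `L → 0` (as `T_N ≤ N(1 + log N)`) and `N L → ∞`
(as `T_N ≥ (N/2π) log(N/2)`); every condition is implied by finitely many thresholds `c·L ≤ ε`, `c/N ≤ ε`,
`R ≤ N L`, `c/(N L) ≤ ε` (§§1–4), each eventually true. [folklore] -/
theorem stub_bulkAsymptotics : ∀ (M m₁ κ μ' K₂ K₃ C₂ C₃ ρ₃ : ℝ) (T U V L α₀ α b b₀ : ℕ → ℝ),
    0 < M → 0 < m₁ → m₁ ≤ 1 → 0 < κ → 0 < μ' → μ' ≤ m₁ → 0 < K₂ → 0 < K₃ → 0 < C₂ → 0 < C₃ → 0 < ρ₃ →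
    (∀ N : ℕ, 3 ≤ N → N / (2 * Real.pi) * Real.log (N / 2) ≤ T N ∧ T N ≤ N * (1 + Real.log N) ∧
      0 ≤ U N ∧ U N ≤ (N : ℝ) ^ 2 ∧ 0 ≤ V N ∧ V N ≤ (N : ℝ) ^ 3) →
    (∀ N : ℕ, L N = M ^ 2 * T N / (N ^ 2 * m₁)) →
    (∀ N : ℕ, α₀ N = μ' * L N / (4 * M)) →
    (∀ N : ℕ, α N = (M / 2 - α₀ N) / N) →
    (∀ N : ℕ, b N = 8 + α₀ N / L N + α N * T N / L N) →
    (∀ N : ℕ, b₀ N = 8 + N * α N / L N) →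
    ∀ᶠ N : ℕ in Filter.atTop,
      0 < α N ∧ α₀ N ≤ M / 4 ∧
      2 * α N * b N ≤ m₁ ∧ m₁ / 8 ≤ 2 * α N * b N ∧
      K₃ * (C₂ * ((α₀ N + α N * U N) / (L N ^ 2 * b N ^ 3) + (α₀ N + α N * V N) / (L N ^ 3 * b N ^ 5))) ≤
        κ * (2 * α N * b N) ∧
      256 * (C₂ * ((α₀ N + α N * U N) / (L N ^ 2 * b N ^ 3) + (α₀ N + α N * V N) / (L N ^ 3 * b N ^ 5))) ≤ 1 ∧
      2 * α₀ N * b₀ N ≤ m₁ ∧ μ' / 8 ≤ 2 * α₀ N * b₀ N ∧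
      K₃ * (C₂ * (N * α N / (L N ^ 2 * b₀ N ^ 3) + N * α N / (L N ^ 3 * b₀ N ^ 5))) ≤ κ * (2 * α₀ N * b₀ N) ∧
      256 * (C₂ * (N * α N / (L N ^ 2 * b₀ N ^ 3) + N * α N / (L N ^ 3 * b₀ N ^ 5))) ≤ 1 ∧
      C₃ * L N / (4 * ρ₃) ≤ 1 ∧ K₂ * (C₃ * L N / (4 * ρ₃)) ≤ κ * (32 * ρ₃ / M) ∧
      L N + 256 / b N ^ 2 < ρ₃ / 1024 ∧ 256 / b₀ N ^ 2 < ρ₃ / 1024 ∧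
      320 / b N ^ 2 < 4 * L N / N ∧ 160 * (1 / b₀ N ^ 2 + 1 / b N ^ 2) < L N ∧
      256 / b N ^ 2 ≤ 2 * L N / N ∧ 256 / b₀ N ^ 2 ≤ L N / 2 ∧ 4 * L N ≤ ρ₃ / 512 := by
  intro M m₁ κ μ' K₂ K₃ C₂ C₃ ρ₃ T U V L α₀ α b b₀ hM hm₁ _ hκ hμ' hμ'le _ hK₃ hC₂ _ hρ₃ hTUV hL hα₀ hα hb hb₀
  -- the two orders of `L` for `N ≥ 3`
  have hLb : ∀ N : ℕ, 3 ≤ N → 0 ≤ L N ∧ L N ≤ M ^ 2 / m₁ * (1 / (N : ℝ) + Real.log N / N) ∧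
      M ^ 2 / (2 * Real.pi * m₁) * Real.log ((N : ℝ) / 2) ≤ N * L N := fun N hN ↦
    bulkAsym_L_bounds hm₁ (by exact_mod_cast hN) (hTUV N hN).1 (hTUV N hN).2.1 (hL N)
  -- `L → 0`
  have hL0 : Tendsto L atTop (𝓝 0) := by
    have hg : Tendsto (fun N : ℕ ↦ M ^ 2 / m₁ * (1 / (N : ℝ) + Real.log N / N)) atTop (𝓝 0) := by
      have h := (tendsto_one_div_atTop_nhds_zero_nat.add
        ((Real.isLittleO_log_id_atTop.tendsto_div_nhds_zero).comp tendsto_natCast_atTop_atTop)).const_mul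
        (M ^ 2 / m₁)
      rw [add_zero, mul_zero] at h
      exact h
    refine squeeze_zero' ?_ ?_ hg
    · filter_upwards [eventually_ge_atTop 3] with N hN using (hLb N hN).1
    · filter_upwards [eventually_ge_atTop 3] with N hN using (hLb N hN).2.1
  -- `N L → ∞`
  have hNL : Tendsto (fun N : ℕ ↦ (N : ℝ) * L N) atTop atTop := by
    have hg : Tendsto (fun N : ℕ ↦ M ^ 2 / (2 * Real.pi * m₁) * Real.log ((N : ℝ) / 2)) atTop atTop :=
      (Real.tendsto_log_atTop.comp (tendsto_natCast_atTop_atTop.atTop_div_const (by norm_num))).const_mul_atTop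
        (by positivity)
    refine tendsto_atTop_mono' atTop ?_ hg
    filter_upwards [eventually_ge_atTop 3] with N hN using (hLb N hN).2.2
  have hq : Tendsto (fun N : ℕ ↦ 1 / ((N : ℝ) * L N)) atTop (𝓝 0) := tendsto_const_nhds.div_atTop hNL
  -- the four threshold shapes are eventually true
  have evl : ∀ c ε : ℝ, 0 < ε → ∀ᶠ N : ℕ in atTop, c * L N ≤ ε := fun c ε hε ↦ by
    have h := hL0.const_mul c
    rw [mul_zero] at h
    exact h.eventually_le_const hε
  have evn : ∀ c ε : ℝ, 0 < ε → ∀ᶠ N : ℕ in atTop, c / (N : ℝ) ≤ ε := fun c ε hε ↦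
    (tendsto_const_div_atTop_nhds_zero_nat c).eventually_le_const hε
  have evq : ∀ c ε : ℝ, 0 < ε → ∀ᶠ N : ℕ in atTop, c * (1 / ((N : ℝ) * L N)) ≤ ε := fun c ε hε ↦ by
    have h := hq.const_mul c
    rw [mul_zero] at h
    exact h.eventually_le_const hε
  have evR : ∀ R : ℝ, ∀ᶠ N : ℕ in atTop, R ≤ (N : ℝ) * L N := fun R ↦ hNL.eventually_ge_atTop R
  filter_upwards [eventually_ge_atTop 3, evl (μ' / (4 * M)) (M / 4) (by positivity),
    evn (M * (8 + μ' / (4 * M))) (m₁ / 2) (by positivity), evR 1,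
    evq (K₃ * C₂ *
      (16 * μ' * M ^ 2 / m₁ ^ 3 + 32 * M ^ 4 / m₁ ^ 3 + 256 * μ' * M ^ 4 / m₁ ^ 5 + 512 * M ^ 6 / m₁ ^ 5))
      (κ * (m₁ / 8)) (by positivity),
    evq (256 * C₂ *
      (16 * μ' * M ^ 2 / m₁ ^ 3 + 32 * M ^ 4 / m₁ ^ 3 + 256 * μ' * M ^ 4 / m₁ ^ 5 + 512 * M ^ 6 / m₁ ^ 5))
      1 one_pos,
    evl (4 * μ' / M) (m₁ / 2) (by positivity), hL0.eventually_le_const one_pos,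
    evl (K₃ * C₂ * (32 / M ^ 2 + 512 / M ^ 4)) (κ * (μ' / 8)) (by positivity),
    evl (256 * C₂ * (32 / M ^ 2 + 512 / M ^ 4)) 1 one_pos, evl (C₃ / (4 * ρ₃)) 1 one_pos,
    evl (K₂ * C₃ / (4 * ρ₃)) (κ * (32 * ρ₃ / M)) (by positivity),
    hL0.eventually_le_const (show (0 : ℝ) < ρ₃ / 4096 by positivity),
    evn (4096 * M ^ 2 / m₁ ^ 2) (ρ₃ / 4096) (by positivity), evR (1280 * M ^ 2 / m₁ ^ 2 + 1),
    evl (2560 / M ^ 2) (1 / 4) (by positivity), evR (4 * (2560 * M ^ 2 / m₁ ^ 2)), evR (2048 * M ^ 2 / m₁ ^ 2),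
    evl (4096 / M ^ 2) (1 / 2) (by positivity), evl 4 (ρ₃ / 512) (by positivity)] with N hN h2 h3 hnl h5 h6 h7
    hl1 h9 h10 h11 h12 h13a h13b h15 h16a h16b h17 h18 h19
  -- the bookkeeping at this `N` (§§1–4)
  obtain ⟨ht1, -, hu, hu', hv, hv'⟩ := hTUV N hN
  have hn : (3 : ℝ) ≤ N := by exact_mod_cast hN
  have hn0 : (0 : ℝ) < N := by linarith
  have hn1 : (1 : ℝ) ≤ N := by linarith
  have ht : 0 < T N := bulkAsym_t_pos hn ht1
  have hl0 : 0 < L N := by rw [hL N]; positivity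
  have ha0nn : 0 ≤ α₀ N := by rw [hα₀ N]; positivity
  have hsmall : α₀ N ≤ M / 4 := by
    rw [hα₀ N]
    calc μ' * L N / (4 * M) = μ' / (4 * M) * L N := by ring
      _ ≤ M / 4 := h2
  obtain ⟨ha_ge, ha_le, ha_pos, hna⟩ := bulkAsym_a_bounds hM hn0 ha0nn hsmall (hα N)
  obtain ⟨hbb_ge, hs, c3, c4⟩ :=
    bulkAsym_ring hM hm₁ hμ' hn0 ha_ge ha_le (bulkAsym_bb_eq hM hm₁ hn0 ht (hL N) (hα₀ N) (hb N)) h3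
  have hW := bulkAsym_ringW hM hm₁ hμ' hn1 hl0 hnl (le_of_eq (hα₀ N)) ha_le hbb_ge hu hu' hv hv'
  obtain ⟨c7, c8⟩ := bulkAsym_centreMass hM hμ' hμ'le hl0 (hα₀ N) hsmall hna (hb₀ N) h7
  obtain ⟨hb0_ge, hs0⟩ := bulkAsym_b0_bounds hM hl0 hsmall hna (hb₀ N)
  have hW0 := bulkAsym_centreW hM hl0 hl1 (by rw [hna]; linarith) hb0_ge
  obtain ⟨c13, c14, c15, c16, c17, c18, c19⟩ :=
    bulkAsym_separation hm₁ hn1 hl0 hs hs0 h13a h13b h15 h16a h16b h17 h18 h19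
  refine ⟨ha_pos, hsmall, c3, c4, ?_, ?_, c7, c8, ?_, ?_, ?_, ?_, c13, c14, c15, c16, c17, c18, c19⟩
  · refine le_trans (mul_le_mul_of_nonneg_left (mul_le_mul_of_nonneg_left hW hC₂.le) hK₃.le) ?_
    calc _ = K₃ * C₂ *
          (16 * μ' * M ^ 2 / m₁ ^ 3 + 32 * M ^ 4 / m₁ ^ 3 + 256 * μ' * M ^ 4 / m₁ ^ 5 + 512 * M ^ 6 / m₁ ^ 5) *
          (1 / ((N : ℝ) * L N)) := by ring
      _ ≤ κ * (m₁ / 8) := h5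
      _ ≤ κ * (2 * α N * b N) := by gcongr
  · refine le_trans (mul_le_mul_of_nonneg_left (mul_le_mul_of_nonneg_left hW hC₂.le) (by norm_num)) ?_
    calc _ = 256 * C₂ *
          (16 * μ' * M ^ 2 / m₁ ^ 3 + 32 * M ^ 4 / m₁ ^ 3 + 256 * μ' * M ^ 4 / m₁ ^ 5 + 512 * M ^ 6 / m₁ ^ 5) *
          (1 / ((N : ℝ) * L N)) := by ring
      _ ≤ 1 := h6
  · refine le_trans (mul_le_mul_of_nonneg_left (mul_le_mul_of_nonneg_left hW0 hC₂.le) hK₃.le) ?_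
    calc _ = K₃ * C₂ * (32 / M ^ 2 + 512 / M ^ 4) * L N := by ring
      _ ≤ κ * (μ' / 8) := h9
      _ ≤ κ * (2 * α₀ N * b₀ N) := by gcongr
  · refine le_trans (mul_le_mul_of_nonneg_left (mul_le_mul_of_nonneg_left hW0 hC₂.le) (by norm_num)) ?_
    calc _ = 256 * C₂ * (32 / M ^ 2 + 512 / M ^ 4) * L N := by ring
      _ ≤ 1 := h10
  · calc C₃ * L N / (4 * ρ₃) = C₃ / (4 * ρ₃) * L N := by ring
      _ ≤ 1 := h11
  · calc K₂ * (C₃ * L N / (4 * ρ₃)) = K₂ * C₃ / (4 * ρ₃) * L N := by ring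
      _ ≤ κ * (32 * ρ₃ / M) := h12

end Summit.FinalStateConjecture.FinalStateConjecture.Theorems.SwallowTheDatum.ParametricKerrBurial
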